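import Literature.MathematicalPhysics.QuantumFieldTheory.Balaban1983to89.Node00.Record13
import Literature.MathematicalPhysics.QuantumFieldTheory.Balaban1983to89.Beta.Drift

/-!
# Sketch — idea-3 g2 (lens: ideate-on-items, third angle): WINDOW-SHELL CAUCHY for K2⁷ `EndpointGivenBR13SepCoPH`

First lemmas of the crux idea card `window-shell-cauchy` (crux item stmt-QuantumFields-20543), stated over
tree declarations only.  Nothing here proves the Clay YM mass gap; K2⁷ feeds `BalabanUVNodes.closes`, whose
conclusion is the CONDITIONAL finite-𝕋⁴ rung `BalabanLadder.UV` only.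

* `withWindow θ ε'`      — the (2.9)-window family through `θ` (same letters, threshold `ε'`);
* `betaOfRecord₁₃_withWindow` — `rfl`: the window enters the record's β ONLY through `chiFixed29 F 2 θ.ν ε'`;
* `WindowShellCauchyAt` ∕ `WindowShellCauchy` — (Q): two windows `ε' ≤ θ.ε₂₉` give merged β's that differ by a Gaussian SHELL TAIL
                           `C·exp(−c (ε'/γ)²)` on the box `]0,γ]^{k+1}`, uniformly in `k`;
* `WindowGradeRemainderAt` — (S1): print-grade `O(ε')` box remainder at EVERY small window, seam-free, relative to a
                           window-independent reference sequence `b`;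
* `EverySlopeRef`        — the currency the (D4) consumers of LINE 1 ∕ idea `jets-referenced-box` buy;
* `everySlopeRef_of_windowShell` — PROVED junction: (Q) ∧ (S1) ⇒ EverySlopeRef at the FIXED-window record (window
                           optimisation `ε' = ε'(s)`, then `γ = γ(ε', s)` from the tail).
-/

open Literature.MathematicalPhysics.QuantumFieldTheory.Balaban1983to89
open Literature.MathematicalPhysics.QuantumFieldTheory.Balaban1983to89.Node00

namespace YMNodeOIdeate.Idea3.WindowShell

variable (F : T4Continuum.T4Family)

/-- The (2.9)-window family through `θ`: every letter of `θ` kept, the threshold replaced by `ε'`. -/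
abbrev withWindow (θ : Stage13Params F 2) (ε' : ℝ) : Stage13Params F 2 := { θ with ε₂₉ := ε' }

/-- CHEAPEST FALSIFIER (F1), kernel-checked: along the family the record's β changes ONLY through the β-slot
species `chiFixed29 F 2 θ.ν ε'` — transport, merged-term family, `ρ8`, `bV`, `v₀`, `γ` are the same term. -/
theorem betaOfRecord₁₃_withWindow (θ : Stage13Params F 2) (ε' : ℝ) :
    betaOfRecord₁₃ F 2 (withWindow F θ ε') =
      betaOfRecord₈Tχ F 2 (TβOfRecord₁₃ F 2) (chiFixed29 F 2 θ.ν ε') θ.toStage8Params := rfl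

/-- **(Q) WINDOW-SHELL CAUCHY ESTIMATE** (the lever). For an admissible `θ` there are `C`, `c > 0`, `γw > 0` such that
for every inner window `0 < ε' ≤ θ.ε₂₉`, every `0 < γ ≤ γw`, every step `k` and every history `v ∈ ]0,γ]^{k+1}`,
the merged β of record at window `θ.ε₂₉` and at window `ε'` differ by at most `C·exp(−c·(ε'/γ)²)`: the two
restricted Gaussian-regime integrals differ only on the SHELL `ε' ≤ |V^{(k)}(V̄)(b)⁻¹V(b) − 1| < θ.ε₂₉` of ONE
bond variable (telescoping `∏χ_ε − ∏χ_{ε'}` one factor at a time + locality), whose weight under the step's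
fluctuation measure (covariance bounded uniformly in `k`, window `≈ ε'/g_k ≥ ε'/γ` in Gaussian units) is a
Gaussian tail.  Informal; to be supplied from [I] §2 (2.9)–(2.12), [II] §1 (1.18)-type activity bounds with ONE
bounded `[0,1]`-valued shell insertion. -/
def WindowShellCauchyAt (θ : Stage13Params F 2) : Prop :=
  ∃ C c γw : ℝ, 0 < c ∧ 0 < γw ∧ γw ≤ θ.γ ∧
    ∀ ε' : ℝ, 0 < ε' → ε' ≤ θ.ε₂₉ →
    ∀ γ : ℝ, 0 < γ → γ ≤ γw →
    ∀ (k : ℕ) (v : Fin (k + 1) → ℝ), v ∈ FlowStep.Box γ k →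
      |betaOfRecord₁₃ F 2 θ k v - betaOfRecord₁₃ F 2 (withWindow F θ ε') k v|
        ≤ C * Real.exp (-(c * (ε' / γ) ^ 2))

/-- (Q) as a statement about the family: claimed ONLY on print's small-window range `0 < θ.ε₂₉ ≤ εQ` (outside it the
(2.9) window is not a small-field window and no Gaussian domination is available — see the card's typing remark on
`Stage13Params.Admissible`, which carries no upper bound on `ε₂₉`). -/
def WindowShellCauchy : Prop :=
  ∃ εQ : ℝ, 0 < εQ ∧ ∀ θ : Stage13Params F 2, θ.Admissible F 2 → θ.ε₂₉ ≤ εQ → WindowShellCauchyAt F θ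

/-- **(S1) PRINT-GRADE REMAINDER ALONG THE WINDOW FAMILY** (print's currency, [II] (1.18)/(1.22): `|β − b| ≤ K·ε₁`
with `ε₁` the (2.9) threshold, at EVERY sufficiently small threshold, relative to ONE window-independent reference
sequence `b` — the structural one-loop numbers; NO seam `K·ε' ≤ slope` is asked). -/
def WindowGradeRemainderAt (θ : Stage13Params F 2) : Prop :=
  ∃ (b : ℕ → ℝ) (εc Kr : ℝ), 0 < εc ∧ 0 ≤ Kr ∧
    ∀ ε' : ℝ, 0 < ε' → ε' ≤ εc →
    ∃ γa : ℝ, 0 < γa ∧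
    ∀ (k : ℕ) (v : Fin (k + 1) → ℝ), v ∈ FlowStep.Box γa k →
      |betaOfRecord₁₃ F 2 (withWindow F θ ε') k v - b k| ≤ Kr * ε'

/-- **THE CURRENCY BOUGHT**: every-slope box remainder of the FIXED-window record β relative to `b`
(`∀ s > 0 ∃ γ > 0 ∀ k ∀ v ∈ ]0,γ]^{k+1}, |β₁₃(θ) k v − b k| ≤ s`). -/
def EverySlopeRef (θ : Stage13Params F 2) (b : ℕ → ℝ) : Prop :=
  ∀ s : ℝ, 0 < s → ∃ γ : ℝ, 0 < γ ∧
    ∀ (k : ℕ) (v : Fin (k + 1) → ℝ), v ∈ FlowStep.Box γ k → |betaOfRecord₁₃ F 2 θ k v - b k| ≤ s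

variable {F}

/-- Boxes are monotone in the side. -/
theorem box_mono {γ γ' : ℝ} (h : γ ≤ γ') {k : ℕ} {v : Fin (k + 1) → ℝ} (hv : v ∈ FlowStep.Box γ k) :
    v ∈ FlowStep.Box γ' k := by
  rw [FlowStep.mem_box] at hv ⊢
  exact fun i => ⟨(hv i).1, (hv i).2.trans h⟩

/-- Elementary tail bookkeeping: for `C`, `c > 0`, `s > 0` there is `M ≥ 0` with `C·exp(−c·t²) ≤ s/2` whenever `t ≥ M + 1`. -/
theorem tail_small (C : ℝ) {c s : ℝ} (hc : 0 < c) (hs : 0 < s) :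
    ∃ M : ℝ, 0 ≤ M ∧ ∀ t : ℝ, M + 1 ≤ t → C * Real.exp (-(c * t ^ 2)) ≤ s / 2 := by
  by_cases hC : C ≤ 0
  · refine ⟨0, le_rfl, fun t _ => ?_⟩
    have : C * Real.exp (-(c * t ^ 2)) ≤ 0 :=
      mul_nonpos_of_nonpos_of_nonneg hC (Real.exp_pos _).le
    linarith
  · push Not at hC
    refine ⟨2 * C / (c * s), by positivity, fun t ht => ?_⟩
    set M : ℝ := 2 * C / (c * s) with hM
    have hM0 : 0 ≤ M := by positivity
    have ht1 : 1 ≤ t := by linarith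
    have ht0 : 0 < t := by linarith
    -- t² ≥ t ≥ M + 1 > M
    have htsq : M + 1 ≤ t ^ 2 := by nlinarith
    have hx : 0 < c * t ^ 2 := by positivity
    -- exp(-x) ≤ 1/(1+x) ≤ 1/x
    have hexp : Real.exp (-(c * t ^ 2)) ≤ 1 / (c * t ^ 2) := by
      rw [Real.exp_neg, ← one_div]
      apply one_div_le_one_div_of_le hx
      have := Real.add_one_le_exp (c * t ^ 2)
      linarith
    have hct : 2 * C / s ≤ c * t ^ 2 := by
      have : c * (M + 1) ≤ c * t ^ 2 := mul_le_mul_of_nonneg_left htsq hc.le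
      have hcM : c * M = 2 * C / s := by
        rw [hM]; field_simp
      nlinarith
    calc C * Real.exp (-(c * t ^ 2)) ≤ C * (1 / (c * t ^ 2)) :=
          mul_le_mul_of_nonneg_left hexp hC.le
      _ ≤ C * (1 / (2 * C / s)) := by
          apply mul_le_mul_of_nonneg_left _ hC.le
          exact one_div_le_one_div_of_le (by positivity) hct
      _ = s / 2 := by field_simp

/-- **JUNCTION (proved): (Q) ∧ (S1) ⇒ the every-slope box remainder at the FIXED-window record.**
Window optimisation: given the slope `s`, take the inner window `ε' = min(εc, θ.ε₂₉, s∕(2(Kr+1)))`, so that print's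
grade gives `Kr·ε' ≤ s/2` at window `ε'`; then take `γ ≤ min(γw, γa(ε'), ε'/(M+1))`, so the shell tail is `≤ s/2`. -/
theorem everySlopeRef_of_windowShell {θ : Stage13Params F 2} (hε29 : 0 < θ.ε₂₉)
    (hQ : WindowShellCauchyAt F θ) (hS : WindowGradeRemainderAt F θ) : ∃ b : ℕ → ℝ, EverySlopeRef F θ b := by
  obtain ⟨b, εc, Kr, hεc, hKr, hS1⟩ := hS
  obtain ⟨C, c, γw, hc, hγw, -, hQ1⟩ := hQ
  refine ⟨b, fun s hs => ?_⟩
  -- the inner window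
  set ε' : ℝ := min (min εc θ.ε₂₉) (s / (2 * (Kr + 1))) with hε'
  have hε'pos : 0 < ε' := lt_min (lt_min hεc hε29) (by positivity)
  have hε'c : ε' ≤ εc := (min_le_left _ _).trans (min_le_left _ _)
  have hε'29 : ε' ≤ θ.ε₂₉ := (min_le_left _ _).trans (min_le_right _ _)
  have hgrade : Kr * ε' ≤ s / 2 := by
    have h1 : ε' ≤ s / (2 * (Kr + 1)) := min_le_right _ _
    have h2 : Kr * ε' ≤ Kr * (s / (2 * (Kr + 1))) := mul_le_mul_of_nonneg_left h1 hKr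
    have h3 : Kr * (s / (2 * (Kr + 1))) ≤ s / 2 := by
      rw [show Kr * (s / (2 * (Kr + 1))) = (s / 2) * (Kr / (Kr + 1)) by field_simp]
      have hK1 : Kr / (Kr + 1) ≤ 1 := by
        rw [div_le_one (by linarith)]; linarith
      calc (s / 2) * (Kr / (Kr + 1)) ≤ (s / 2) * 1 := mul_le_mul_of_nonneg_left hK1 (by linarith)
        _ = s / 2 := mul_one _
    exact h2.trans h3
  obtain ⟨γa, hγa, hS2⟩ := hS1 ε' hε'pos hε'c
  obtain ⟨M, hM0, htail⟩ := tail_small C hc hs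
  -- the box side
  set γ : ℝ := min (min γw γa) (ε' / (M + 1)) with hγ
  have hγpos : 0 < γ := lt_min (lt_min hγw hγa) (by positivity)
  have hγw' : γ ≤ γw := (min_le_left _ _).trans (min_le_left _ _)
  have hγa' : γ ≤ γa := (min_le_left _ _).trans (min_le_right _ _)
  have hγt : γ ≤ ε' / (M + 1) := min_le_right _ _
  have hratio : M + 1 ≤ ε' / γ := by
    rw [le_div_iff₀ hγpos]
    have : γ * (M + 1) ≤ ε' := by
      have := (le_div_iff₀ (show (0:ℝ) < M + 1 by positivity)).mp hγt
      linarith [this]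
    linarith
  refine ⟨γ, hγpos, fun k v hv => ?_⟩
  have hvQ := hQ1 ε' hε'pos hε'29 γ hγpos hγw' k v hv
  have hvS := hS2 k v (box_mono hγa' hv)
  have ht := htail (ε' / γ) hratio
  calc |betaOfRecord₁₃ F 2 θ k v - b k|
      = |(betaOfRecord₁₃ F 2 θ k v - betaOfRecord₁₃ F 2 (withWindow F θ ε') k v)
          + (betaOfRecord₁₃ F 2 (withWindow F θ ε') k v - b k)| := by ring_nf
    _ ≤ |betaOfRecord₁₃ F 2 θ k v - betaOfRecord₁₃ F 2 (withWindow F θ ε') k v|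
          + |betaOfRecord₁₃ F 2 (withWindow F θ ε') k v - b k| := abs_add_le _ _
    _ ≤ s / 2 + s / 2 := add_le_add (hvQ.trans ht) (hvS.trans hgrade)
    _ = s := by ring

/-- **DOWNSTREAM (proved): the currency feeds END's exact drawdown input.**  If the reference sequence `b` DRIFTS with a
positive slope `d` (`Beta.Drift.OneLoopDrift d A b`: `|Σ_{j<k} b_j − d·k| ≤ A` — the (D1) input in jets-referenced form)
and the record's β has the every-slope box remainder relative to `b`, then along every `]0,γ]`-history the partial sums
of the record's β are bounded below by `−2A` (`FlowStepRuns.BetaPartialSumsLowerH`, the hypothesis of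
`FlowStepRuns.endpointExistence_of_partialSums` :593 together with `BetaContH`, `BetaUpperH`, `ForwardGenerated`).
Choose the slope `s := d`. -/
theorem betaPartialSumsLowerH_of_everySlopeRef {θ : Stage13Params F 2} {b : ℕ → ℝ} {d A : ℝ} (hd : 0 < d)
    (hdrift : Beta.Drift.OneLoopDrift d A b) (hE : EverySlopeRef F θ b) :
    ∃ γ : ℝ, 0 < γ ∧ FlowStepRuns.BetaPartialSumsLowerH (2 * A) γ (betaOfRecord₁₃ F 2 θ) := by
  obtain ⟨γ, hγ, hbox⟩ := hE d hd
  refine ⟨γ, hγ, fun g hg k n hkn => ?_⟩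
  have hstep : ∀ j, b j - d ≤ betaOfRecord₁₃ F 2 θ j (FlowStep.prefixOf g j) := fun j => by
    have hp : FlowStep.prefixOf g j ∈ FlowStep.Box γ j := by
      rw [FlowStep.mem_box]; intro i; simpa using hg i
    have h2 := abs_le.mp (hbox j _ hp)
    linarith [h2.1]
  have hsum : ∑ j ∈ Finset.Ico k n, (b j - d) ≤ ∑ j ∈ Finset.Ico k n, betaOfRecord₁₃ F 2 θ j (FlowStep.prefixOf g j) :=
    Finset.sum_le_sum fun j _ => hstep j
  have hsplit : ∑ j ∈ Finset.Ico k n, (b j - d) = ∑ j ∈ Finset.Ico k n, b j - d * ((n : ℝ) - k) := by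
    rw [Finset.sum_sub_distrib, Finset.sum_const, Nat.card_Ico, nsmul_eq_mul, Nat.cast_sub hkn]
    ring
  have hdr := Beta.Drift.sum_Ico_ge_of_drift hdrift hkn
  linarith

end YMNodeOIdeate.Idea3.WindowShell
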